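import Mathlib
import HarnessLib
import HarnessLib.Audit
import Summits.CriticalPhenomena.PercolationContinuityZ3.Theorems.PercNearOneGluingNoHeavyLowerTailHexMSDelta

/-!
# Δ-R_n holds in every direction whose twins are label-constant (hp-7 gen 67)

Support file for crux `stmt-CriticalPhenomena-4575` (route `PercNearOneGluingNoHeavy`), hull-port seat `prim-hp-7` (generation 67);
`--supports stmt-CriticalPhenomena-4575`.  No `sorry`.  Memo: `run/shared/lean/prim/prim-hp-7/FROM-prim-hp-7-g67-EXTREME-DIRECTIONS.md`.

Vocabulary of `…HexMSDelta` (g65): an antipodal instance `(U, 𝒟, x)`, its far meets and joins `symGen U 𝒟 x`, the `r`-twins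
`twins 𝒟 r = {e ∈ 𝒟 : r ∉ e, insert r e ∈ 𝒟}` and the `r`-edges `edgesAt G r` of a family.  Conjecture Δ-R_n (`DeltaRn`) asks for a
direction `r` with `#(twins 𝒟 r) ≤ #(edgesAt (symGen U 𝒟 x) r)`; the 'for every `r`' form is false.

**The fibre trick** (`card_twins_le_card_edgesAt_of_constant`): if every `r`-twin is LABEL-CONSTANT (`x (insert r e) = x e`), then the
twins themselves form an antipodal instance on `U.erase r` (complements `(U.erase r) \ e = U \ insert r e`), and every far meet / far
join of two twins is an `r`-edge of `symGen U 𝒟 x` (both `p` and `insert r p` are products of `𝒟`, with the same label pattern on both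
floors).  Hence Δ-HEX for the twin instance (`DeltaHexRel (U.erase r) (twins 𝒟 r) x`, one dimension down) gives the Δ-R_n inequality in
direction `r`.  Gen-67 census: in every extremal instance found (n = 6, 7, 8 with n − 1 deficient directions, e.g. the tight robust
40-pair instance X7b on `2^[7]`) the unique non-deficient direction is exactly such an all-constant direction; directions all of whose
twins are SHIFTED can be deficient (X6, direction 1: 12 twins, 10 edges), so constancy cannot be weakened to 'no far twins'.
-/

namespace Summit.CriticalPhenomena.PercolationContinuityZ3.Theorems

namespace GeneratedDonors

open Finset

variable {α : Type*} [DecidableEq α]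

section ConstantTwins

variable {U : Finset α} {r : α} {𝒟 : Finset (Finset α)} {x : Finset α → ZMod 6}

/-- Of two labels that are not close, the first is close to the antipode of the second. -/
theorem close_add_three_of_not_close {s t : ZMod 6} (h : ¬ Close s t) : Close s (t + 3) := by
  revert s t; decide

/-- In an antipodal instance on `U`, the meet of two members with far (= not close) labels is a generated difference:
`e ∩ f = e \ (U \ f)` with `x (U \ f) = x f + 3` close to `x e`. -/
theorem inter_mem_gen_of_not_close (hU : ∀ a ∈ 𝒟, a ⊆ U) (hco : ∀ a ∈ 𝒟, U \ a ∈ 𝒟)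
    (hanti : ∀ a ∈ 𝒟, x (U \ a) = x a + 3) {e f : Finset α} (he : e ∈ 𝒟) (hf : f ∈ 𝒟)
    (hfar : ¬ Close (x e) (x f)) : e ∩ f ∈ gen 𝒟 x := by
  rw [mem_gen]
  refine ⟨e, he, U \ f, hco f hf, ?_, sdiff_univ_compl_eq_inter (hU e he)⟩
  rw [hanti f hf]
  exact close_add_three_of_not_close hfar

/-- Complement inside `U.erase r` of an `r`-free set is the complement in `U` of the set with `r` inserted. -/
theorem erase_sdiff_eq_sdiff_insert (U : Finset α) (r : α) (p : Finset α) :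
    (U.erase r) \ p = U \ insert r p := by
  ext i; simp only [mem_sdiff, mem_erase, mem_insert]; tauto

/-- For `r ∈ U` and `r ∉ p`: inserting `r` into `U \ insert r p` gives `U \ p`. -/
theorem insert_sdiff_insert (hr : r ∈ U) {p : Finset α} (hp : r ∉ p) :
    insert r (U \ insert r p) = U \ p := by
  ext i
  simp only [mem_insert, mem_sdiff]
  constructor
  · rintro (rfl | ⟨hiU, hi⟩)
    · exact ⟨hr, hp⟩
    · exact ⟨hiU, fun h => hi (Or.inr h)⟩
  · rintro ⟨hiU, hip⟩
    by_cases hir : i = r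
    · exact Or.inl hir
    · exact Or.inr ⟨hiU, fun h => h.elim hir hip⟩

/-- Twins are `r`-free subsets of `U.erase r`. -/
theorem twins_subset_erase (hU : ∀ a ∈ 𝒟, a ⊆ U) {e : Finset α} (he : e ∈ twins 𝒟 r) : e ⊆ U.erase r := by
  obtain ⟨heD, hre, _⟩ := mem_twins.mp he
  intro i hi
  exact mem_erase.mpr ⟨fun h => hre (h ▸ hi), hU e heD hi⟩

/-- If all `r`-twins are label-constant, the twin family with the restricted labels is antipodal on `U.erase r`. -/
theorem twins_anti_of_constant (hanti : ∀ a ∈ 𝒟, x (U \ a) = x a + 3)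
    (hconst : ∀ e ∈ twins 𝒟 r, x (insert r e) = x e) :
    ∀ e ∈ twins 𝒟 r, x ((U.erase r) \ e) = x e + 3 := by
  intro e he
  obtain ⟨_, _, hins⟩ := mem_twins.mp he
  rw [erase_sdiff_eq_sdiff_insert, hanti _ hins, hconst e he]

/-- **Both floors.**  If the `r`-twins are label-constant, a generated difference `p` of the twin instance is an `r`-edge of
`gen 𝒟 x`: both `p` and `insert r p` are generated by `𝒟`. -/
theorem gen_twins_mem_and_insert_mem (hconst : ∀ e ∈ twins 𝒟 r, x (insert r e) = x e)
    {p : Finset α} (hp : p ∈ gen (twins 𝒟 r) x) :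
    p ∈ gen 𝒟 x ∧ r ∉ p ∧ insert r p ∈ gen 𝒟 x := by
  obtain ⟨a, ha, b, hb, hcl, rfl⟩ := mem_gen.mp hp
  obtain ⟨haD, hra, hains⟩ := mem_twins.mp ha
  obtain ⟨hbD, hrb, _⟩ := mem_twins.mp hb
  refine ⟨mem_gen.mpr ⟨a, haD, b, hbD, hcl, rfl⟩, fun h => hra (mem_sdiff.mp h).1, ?_⟩
  have hins : insert r (a \ b) = insert r a \ b := by
    ext i
    simp only [mem_insert, mem_sdiff]
    constructor
    · rintro (rfl | ⟨hia, hib⟩)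
      · exact ⟨Or.inl rfl, hrb⟩
      · exact ⟨Or.inr hia, hib⟩
    · rintro ⟨rfl | hia, hib⟩
      · exact Or.inl rfl
      · exact Or.inr ⟨hia, hib⟩
  rw [hins]
  refine mem_gen.mpr ⟨insert r a, hains, b, hbD, ?_, rfl⟩
  rw [hconst a ha]; exact hcl

/-- **The symmetric generated family of the (constant-)twin instance consists of `r`-edges of `symGen U 𝒟 x`.** -/
theorem symGen_twins_subset_edgesAt (hr : r ∈ U) (hconst : ∀ e ∈ twins 𝒟 r, x (insert r e) = x e) :
    symGen (U.erase r) (twins 𝒟 r) x ⊆ edgesAt (symGen U 𝒟 x) r := by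
  intro q hq
  unfold symGen at hq
  rw [mem_edgesAt]
  rcases mem_union.mp hq with hq | hq
  · obtain ⟨h1, h2, h3⟩ := gen_twins_mem_and_insert_mem hconst hq
    unfold symGen
    exact ⟨mem_union_left _ h1, h2, mem_union_left _ h3⟩
  · obtain ⟨p, hp, rfl⟩ := mem_image.mp hq
    obtain ⟨h1, h2, h3⟩ := gen_twins_mem_and_insert_mem hconst hp
    unfold symGen
    refine ⟨?_, ?_, ?_⟩
    · rw [erase_sdiff_eq_sdiff_insert]
      exact mem_union_right _ (mem_image.mpr ⟨insert r p, h3, rfl⟩)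
    · intro h
      exact ((mem_erase.mp (mem_sdiff.mp h).1).1) rfl
    · rw [erase_sdiff_eq_sdiff_insert, insert_sdiff_insert hr h2]
      exact mem_union_right _ (mem_image.mpr ⟨p, h1, rfl⟩)

/-- **Δ-R_n in an all-constant direction (the fibre trick).**  In an antipodal instance on `U` with `r ∈ U`, if every `r`-twin `e` has
`x (insert r e) = x e`, then Δ-HEX for the twin instance on `U.erase r` yields `#(twins 𝒟 r) ≤ #(edgesAt (symGen U 𝒟 x) r)` — the
edge inequality of Conjecture Δ-R_n holds in direction `r`. -/
theorem card_twins_le_card_edgesAt_of_constant (hr : r ∈ U) (hU : ∀ a ∈ 𝒟, a ⊆ U) (hco : ∀ a ∈ 𝒟, U \ a ∈ 𝒟)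
    (hanti : ∀ a ∈ 𝒟, x (U \ a) = x a + 3) (hconst : ∀ e ∈ twins 𝒟 r, x (insert r e) = x e)
    (hIH : DeltaHexRel (U.erase r) (twins 𝒟 r) x) :
    #(twins 𝒟 r) ≤ #(edgesAt (symGen U 𝒟 x) r) := by
  have h1 : #(twins 𝒟 r) ≤ #(symGen (U.erase r) (twins 𝒟 r) x) :=
    hIH (fun e he => twins_subset_erase hU he) (fun e he => compl_erase_mem_twins hr hco he)
      (twins_anti_of_constant hanti hconst)
  exact h1.trans (card_le_card (symGen_twins_subset_edgesAt hr hconst))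

/-- **Corollary (one induction step).**  If Δ-HEX holds for every antipodal instance on `U.erase r` and the instance on `U` has an
all-constant direction `r ∈ U`, then Δ-HEX holds for it: combine the fibre trick with the g65 coordinate reduction
`card_le_card_symGen_of_reduction`. -/
theorem deltaHexRel_of_constant_direction (hr : r ∈ U)
    (hconst : ∀ e ∈ twins 𝒟 r, x (insert r e) = x e)
    (hdown : ∀ (ℰ : Finset (Finset α)) (y : Finset α → ZMod 6), DeltaHexRel (U.erase r) ℰ y) :
    DeltaHexRel U 𝒟 x := by
  intro hU hco hanti
  classical
  have hedge := card_twins_le_card_edgesAt_of_constant hr hU hco hanti hconst (hdown _ _)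
  -- a half H of the twins under the complement-in-(U.erase r) involution (as in `deltaHexRel_of_deltaRn_aux`)
  set σ : Finset α → Finset α := fun e => (U.erase r) \ e with hσ
  have hcl : ∀ s ∈ twins 𝒟 r, σ s ∈ twins 𝒟 r := fun s hs => compl_erase_mem_twins hr hco hs
  have hsubTw : ∀ s ∈ twins 𝒟 r, s ⊆ U.erase r := fun s hs => twins_subset_erase hU hs
  have hinv : ∀ s ∈ twins 𝒟 r, σ (σ s) = s := fun s hs => Finset.sdiff_sdiff_eq_self (hsubTw s hs)
  by_cases hsmall : ∃ s ∈ twins 𝒟 r, σ s = s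
  · -- degenerate: U.erase r = ∅, so every member is ∅ or {r}; then 𝒟 ⊆ {∅, {r}} and the bound is direct
    obtain ⟨s, hs, hfix⟩ := hsmall
    have hs0 : s = ∅ := by
      apply eq_empty_of_forall_notMem
      intro i hi
      have : i ∈ σ s := hfix.symm ▸ hi
      exact (mem_sdiff.mp this).2 hi
    have hUe : U.erase r = ∅ := by
      have : σ s = ∅ := by rw [hfix, hs0]
      simpa [hσ, hs0] using this
    have hsub1 : ∀ a ∈ 𝒟, a ⊆ {r} := by
      intro a ha i hi
      rw [mem_singleton]
      by_contra hir
      have : i ∈ U.erase r := mem_erase.mpr ⟨hir, hU a ha hi⟩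
      rw [hUe] at this
      exact notMem_empty i this
    obtain ⟨hsD, _, _⟩ := mem_twins.mp hs
    have h0 : s \ s ∈ gen 𝒟 x := mem_gen.mpr ⟨s, hsD, s, hsD, Or.inl rfl, rfl⟩
    have h1 : s \ s ∈ symGen U 𝒟 x := by unfold symGen; exact mem_union_left _ h0
    have h2 : U \ (s \ s) ∈ symGen U 𝒟 x := by
      unfold symGen; exact mem_union_right _ (mem_image.mpr ⟨_, h0, rfl⟩)
    have hne : s \ s ≠ U \ (s \ s) := by
      rw [sdiff_self, Finset.bot_eq_empty, sdiff_empty]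
      intro hUe'
      exact absurd (hUe' ▸ hr : r ∈ (∅ : Finset α)) (notMem_empty r)
    have hS2 : 2 ≤ #(symGen U 𝒟 x) := by
      have := Finset.one_lt_card.mpr ⟨_, h1, _, h2, hne⟩
      omega
    have hDsub : 𝒟 ⊆ ({r} : Finset α).powerset := fun a ha => mem_powerset.mpr (hsub1 a ha)
    have hD2 : #𝒟 ≤ 2 := by
      have := card_le_card hDsub
      rw [card_powerset, card_singleton] at this
      exact this
    omega
  push Not at hsmall
  obtain ⟨H, hHsub, hHfree, hHcov⟩ := exists_half_of_involution σ (twins 𝒟 r) hcl hinv hsmall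
  have hcardTw : #(twins 𝒟 r) = 2 * #H := card_eq_two_mul_card_half σ _ H hcl hinv hHsub hHfree hHcov
  set E : Finset (Finset α) := 𝒟.filter fun e => r ∉ e with hE
  set E0 : Finset (Finset α) := (E \ twins 𝒟 r) ∪ H with hE0
  have hTwE : twins 𝒟 r ⊆ E := fun s hs => by
    rw [hE, mem_filter]; exact ⟨(mem_twins.mp hs).1, (mem_twins.mp hs).2.1⟩
  have hRD : ReductionData U r 𝒟 E0 := by
    refine ⟨?_, ?_, ?_⟩
    · intro e he
      rw [hE0, mem_union, mem_sdiff] at he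
      rcases he with ⟨he, _⟩ | he
      · exact (mem_filter.mp he).1
      · exact (mem_twins.mp (hHsub he)).1
    · intro e he
      rw [hE0, mem_union, mem_sdiff] at he
      rcases he with ⟨he, _⟩ | he
      · exact (mem_filter.mp he).2
      · exact (mem_twins.mp (hHsub he)).2.1
    · intro e he hce
      rw [hE0, mem_union, mem_sdiff] at he hce
      have htw_of : ∀ f ∈ E, (U.erase r) \ f ∈ E → f ∈ twins 𝒟 r := by
        intro f hf hcf
        rw [hE, mem_filter] at hf hcf
        refine mem_twins.mpr ⟨hf.1, hf.2, ?_⟩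
        have hsub : insert r f ⊆ U := by
          intro i hi
          rcases mem_insert.mp hi with rfl | hif
          · exact hr
          · exact hU f hf.1 hif
        have h1 : U \ ((U.erase r) \ f) = insert r f := by
          rw [erase_sdiff_eq_sdiff_insert, Finset.sdiff_sdiff_eq_self hsub]
        rw [← h1]
        exact hco _ hcf.1
      rcases he with ⟨heE, henT⟩ | heH
      · rcases hce with ⟨hcE, _⟩ | hcH
        · exact henT (htw_of e heE hcE)
        · have hcT := hHsub hcH
          have : e ∈ twins 𝒟 r := by
            have := hcl _ hcT
            rwa [show σ ((U.erase r) \ e) = e from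
              Finset.sdiff_sdiff_eq_self (fun i hi => mem_erase.mpr
                ⟨fun h => (mem_filter.mp heE).2 (h ▸ hi), hU e (mem_filter.mp heE).1 hi⟩)] at this
          exact henT this
      · rcases hce with ⟨_, hcnT⟩ | hcH
        · exact hcnT (hcl e (hHsub heH))
        · exact hHfree e heH hcH
  have hcardD : #𝒟 = 2 * #E := card_eq_two_mul_card_rfree hr hU hco
  have hcardE0 : #E0 + #H = #E := by
    have hdisj : Disjoint (E \ twins 𝒟 r) H := by
      rw [disjoint_left]; intro s hs hsH; exact (mem_sdiff.mp hs).2 (hHsub hsH)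
    rw [hE0, card_union_of_disjoint hdisj, card_sdiff_of_subset hTwE, hcardTw]
    have : #(twins 𝒟 r) ≤ #E := card_le_card hTwE
    omega
  apply card_le_card_symGen_of_reduction hRD hU hco hanti (hdown _ _)
  omega

end ConstantTwins

end GeneratedDonors

end Summit.CriticalPhenomena.PercolationContinuityZ3.Theorems
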